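import Summits.CriticalPhenomena.PercolationContinuityZ3.Theorems.PercNearOneGluingNoHeavyLowerTailQ7PsiReduction
import Literature.Probability.Percolation.KozmaNitzanClusterPropertyReal
import HarnessLib

/-!
# `NoHeavyLowerTail` (stmt-CriticalPhenomena-4575) — the one-relay case of the peeled form of Question 7
# for REAL-valued monotone cluster properties (Kozma–Nitzan's Lemma 3(i), real form)

Support file (`--supports stmt-CriticalPhenomena-4575`), coupling seat `prim-cplus-coupling` (gen 5).  No
definitions, no named facts, no sorries.

Context (seat memo A5-COUPLING-gen5.md §3).  Deleting the target `b` from the graph and writing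
`u(S) = 1 − ∏_{s∈S}(1 − w_{sb})` for the probability that a vertex set `S` has an open edge to `b`, the peeled
form of Kozma–Nitzan's Question 7 (tree: `Q7Psi.q7_of_psi`) reads `E[(u(C(o)) − u(C(z))) ; o ↔ A] ≥ 0` on
`G ∖ b`, under the hypotheses `E u(C(a)) ≥ E u(C(z))`, `a ∈ A` — a statement about ONE percolation and ONE
monotone cluster property in the sense of Kozma–Nitzan §5.1 (p. 31).  The seat conjectures it for every
monotone cluster property ("(GΨ_k)": if `E F(C(aᵢ)) ≥ E F(C(z))` for `i < k` then
`E[(F(C(o)) − F(C(z))) ; o ↔ {a₁,…,a_{k−1}}] ≥ 0`; no violation among ~3 500 linear programmes over all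
monotone `F`), which would give Question 7 for every `|A|`.  This file proves the case `k = 2` in that
generality:

* `Q7Psi.lemma3_i_real` — **Kozma–Nitzan's Lemma 3(i) for a real-valued monotone cluster property**: if
  `F` is monotone on vertex sets, `E F(C(a₁)) ≤ E F(C(a₂))` and `Q = {C_{a₂} ∈ 𝒬}` is an INCREASING event in
  the (edge) cluster of `a₂`, then `E[F(C(a₁)); Q] ≤ E[F(C(a₂)); Q]`.  (The tree has the real form of
  Lemma 3(ii), `KozmaNitzan2024_lemma3_ii_real`, for decreasing events of `C_{a₁}`; the proof here is the
  printed one for 3(i): on `{a₁ ↔ a₂}` the clusters coincide; on `{a₁ ↮ a₂}` BHK Thm. 1.5 (`F(C(a₁))`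
  increasing in `C_{a₁}` against `𝟙_Q` increasing in `C_{a₂}`: negatively correlated), the hypothesis, and
  BHK Thm. 1.3 (both increasing in `C_{a₂}`), in integral form.)
* `Q7Psi.gpsi_two` — (GΨ₂): `E[F(C(z)); o ↔ x] ≤ E[F(C(x)); o ↔ x]` whenever `E F(C(z)) ≤ E F(C(x))`;
* `Q7Psi.gpsi_two_in` — the same with `{o ↔ x in S}` (open path inside a vertex set `S`) in place of
  `{o ↔ x}`; with `S = {b}ᶜ` and `F = u` this is the cluster-property form of `Q7Psi.psi_single`.
[cite: KozmaNitzan2024, Lemma 3(i) (pp. 6–7), §5.1 (pp. 31–32), Question 7 (p. 36)]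
[cite: VandenbergHaggstromKahn2005, Thms 1.3, 1.5]
-/

namespace Summit.CriticalPhenomena.PercolationContinuityZ3.Theorems

open MeasureTheory Set Literature.Probability.LatticeModels Literature.Probability.Percolation
open scoped Classical
open KNPreFKG

noncomputable section

namespace Q7Psi

variable {V : Type*} [Fintype V]

/-- **Kozma–Nitzan's Lemma 3(i) for a real-valued monotone cluster property.**  If `F` is monotone on
vertex sets, `E F(C(a₁)) ≤ E F(C(a₂))`, and `𝒬` is an upper family of edge sets (so `Q = {C_{a₂} ∈ 𝒬}` is an
increasing event in the cluster of `a₂`), then `∫_Q F(C(a₁)) ≤ ∫_Q F(C(a₂))`.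
[cite: KozmaNitzan2024, Lemma 3(i) (pp. 6–7) with §5.1 (p. 31)] [cite: VandenbergHaggstromKahn2005, Thms 1.3, 1.5] -/
theorem lemma3_i_real (w : Sym2 V → unitInterval) (a₁ a₂ : V) (F : Set V → ℝ)
    (hF : ∀ S T : Set V, S ⊆ T → F S ≤ F T)
    (h : ∫ ω, F (openCluster ω a₁) ∂(prodBernoulli w) ≤ ∫ ω, F (openCluster ω a₂) ∂(prodBernoulli w))
    {𝒬 : Set (Set (Sym2 V))} (h𝒬 : IsUpperSet 𝒬) :
    ∫ ω in {ω | openEdgeCluster ω a₂ ∈ 𝒬}, F (openCluster ω a₁) ∂(prodBernoulli w) ≤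
      ∫ ω in {ω | openEdgeCluster ω a₂ ∈ 𝒬}, F (openCluster ω a₂) ∂(prodBernoulli w) := by
  classical
  set μ := prodBernoulli w with hμ
  by_cases h12 : a₁ = a₂
  · subst h12
    exact le_rfl
  set f₁ : BondConfig V → ℝ := fun ω => F (openCluster ω a₁) with hf₁
  set f₂ : BondConfig V → ℝ := fun ω => F (openCluster ω a₂) with hf₂
  set Q : Set (BondConfig V) := {ω | openEdgeCluster ω a₂ ∈ 𝒬} with hQ
  set D : Set (BondConfig V) := {ω | ¬ (openGraph ω).Reachable a₁ a₂} with hD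
  have hmeas : ∀ S : Set (BondConfig V), MeasurableSet S := fun _ => MeasurableSet.of_discrete
  have hint : ∀ (g : BondConfig V → ℝ) (S : Set (BondConfig V)), IntegrableOn g S μ :=
    fun g S => (Integrable.of_finite).integrableOn
  -- on `Dᶜ` the two clusters coincide
  have hagree : ∀ ω, ω ∉ D → f₁ ω = f₂ ω := by
    intro ω hω
    have hr : (openGraph ω).Reachable a₁ a₂ := by
      by_contra hc
      exact hω hc
    simp only [hf₁, hf₂]
    rw [openCluster_eq_of_reachable hr]
  have hsplit : ∀ (g : BondConfig V → ℝ) (S : Set (BondConfig V)),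
      ∫ ω in S, g ω ∂μ = ∫ ω in S ∩ D, g ω ∂μ + ∫ ω in S \ D, g ω ∂μ := by
    intro g S
    rw [integral_inter_add_sdiff (hmeas D) (hint g S)]
  have hdiff : ∀ S : Set (BondConfig V), ∫ ω in S \ D, f₁ ω ∂μ = ∫ ω in S \ D, f₂ ω ∂μ := by
    intro S
    refine setIntegral_congr_fun ((hmeas S).diff (hmeas D)) fun ω hω => ?_
    exact hagree ω hω.2
  -- the hypothesis restricted to `D`
  have hH : ∫ ω in D, f₁ ω ∂μ ≤ ∫ ω in D, f₂ ω ∂μ := by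
    have e1 := integral_add_compl (hmeas D) (Integrable.of_finite : Integrable f₁ μ)
    have e2 := integral_add_compl (hmeas D) (Integrable.of_finite : Integrable f₂ μ)
    have e3 : ∫ ω in Dᶜ, f₁ ω ∂μ = ∫ ω in Dᶜ, f₂ ω ∂μ :=
      setIntegral_congr_fun (hmeas D).compl fun ω hω => hagree ω hω
    have h' : ∫ ω, f₁ ω ∂μ ≤ ∫ ω, f₂ ω ∂μ := h
    linarith
  have hind : ∀ ω : BondConfig V, 𝒬.indicator (1 : Set (Sym2 V) → ℝ) (openEdgeCluster ω a₂) =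
      Q.indicator (1 : BondConfig V → ℝ) ω := fun ω => congrFun (indicator_comp_openEdgeCluster 𝒬 a₂) ω
  -- (1) two-cluster BHK (Thm. 1.5): `F(C(a₁))` increasing in `C_{a₁}`, `-𝟙_Q` antitone in `C_{a₂}`
  have h1 := BHK2006_twoClusterConditionalAssociation_holds V w a₁ a₂
    (fun C _ => F {a | a = a₁ ∨ ∃ e ∈ C, a ∈ e}) (fun _ D' => - 𝒬.indicator (1 : Set (Sym2 V) → ℝ) D')
    (fun _ => monotone_clusterFun a₁ F hF) (fun _ => antitone_const) (fun _ => monotone_const)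
    (fun _ _ _ hDD' => neg_le_neg (monotone_indicator_one_of_isUpperSet h𝒬 hDD')) h12
  simp only [clusterFun_openEdgeCluster, hind, mul_neg, integral_neg] at h1
  rw [setIntegral_indicator_one_eq, setIntegral_mul_indicator_one] at h1
  change -((∫ ω in D, f₁ ω ∂μ) * μ.real (D ∩ Q)) ≤ -(μ.real D * ∫ ω in D ∩ Q, f₁ ω ∂μ) at h1
  -- h1 : μ.real D * ∫ in D ∩ Q, f₁ ≤ (∫ in D, f₁) * μ.real (D ∩ Q)   (after rearranging)
  -- (3) one-cluster BHK (Thm. 1.3) inside `C_{a₂}`: `F(C(a₂))` and `𝟙_Q` both increasing, given `a₂ ↮ a₁`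
  have hD2 : {ω : BondConfig V | ∀ x ∈ ({a₁} : Set V), ¬ (openGraph ω).Reachable a₂ x} = D := by
    ext ω
    simp only [mem_singleton_iff, forall_eq, mem_setOf_eq, hD]
    exact not_congr ⟨SimpleGraph.Reachable.symm, SimpleGraph.Reachable.symm⟩
  have h3 := BHK2006_clusterConditionalPositiveAssociation_holds V w a₂ ({a₁} : Set V)
    (fun C => F {a | a = a₂ ∨ ∃ e ∈ C, a ∈ e}) (𝒬.indicator 1) (monotone_clusterFun a₂ F hF)
    (monotone_indicator_one_of_isUpperSet h𝒬) (by simpa using Ne.symm h12)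
  simp only [hD2, clusterFun_openEdgeCluster, hind] at h3
  rw [setIntegral_indicator_one_eq, setIntegral_mul_indicator_one] at h3
  change (∫ ω in D, f₂ ω ∂μ) * μ.real (D ∩ Q) ≤ μ.real D * ∫ ω in D ∩ Q, f₂ ω ∂μ at h3
  have hcore : ∫ ω in D ∩ Q, f₁ ω ∂μ ≤ ∫ ω in D ∩ Q, f₂ ω ∂μ := by
    by_cases hD0 : μ.real D = 0
    · have hDQ0 : μ (D ∩ Q) = 0 := by
        have : μ.real (D ∩ Q) = 0 :=
          le_antisymm ((measureReal_mono inter_subset_left).trans hD0.le) measureReal_nonneg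
        exact (measureReal_eq_zero_iff (measure_ne_top _ _)).1 this
      rw [setIntegral_measure_zero _ hDQ0, setIntegral_measure_zero _ hDQ0]
    · have hDpos : 0 < μ.real D := lt_of_le_of_ne measureReal_nonneg (Ne.symm hD0)
      have hDQ : 0 ≤ μ.real (D ∩ Q) := measureReal_nonneg
      have hchain : μ.real D * ∫ ω in D ∩ Q, f₁ ω ∂μ ≤ μ.real D * ∫ ω in D ∩ Q, f₂ ω ∂μ :=
        calc μ.real D * ∫ ω in D ∩ Q, f₁ ω ∂μ ≤ (∫ ω in D, f₁ ω ∂μ) * μ.real (D ∩ Q) := by linarith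
          _ ≤ (∫ ω in D, f₂ ω ∂μ) * μ.real (D ∩ Q) := mul_le_mul_of_nonneg_right hH hDQ
          _ ≤ μ.real D * ∫ ω in D ∩ Q, f₂ ω ∂μ := h3
      exact le_of_mul_le_mul_left hchain hDpos
  show ∫ ω in Q, f₁ ω ∂μ ≤ ∫ ω in Q, f₂ ω ∂μ
  rw [hsplit f₁ Q, hsplit f₂ Q, inter_comm Q D, hdiff Q]
  linarith [hcore]

/-- **(GΨ₂), the one-relay case of the peeled form for any monotone cluster property**: if
`E F(C(z)) ≤ E F(C(x))` then `E[F(C(z)); o ↔ x] ≤ E[F(C(x)); o ↔ x]`.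
[cite: KozmaNitzan2024, Lemma 3(i) (pp. 6–7), §5.1 (pp. 31–32)] -/
theorem gpsi_two (w : Sym2 V → unitInterval) (o x z : V) (F : Set V → ℝ)
    (hF : ∀ S T : Set V, S ⊆ T → F S ≤ F T)
    (h : ∫ ω, F (openCluster ω z) ∂(prodBernoulli w) ≤ ∫ ω, F (openCluster ω x) ∂(prodBernoulli w)) :
    ∫ ω in openConn o x, F (openCluster ω z) ∂(prodBernoulli w) ≤
      ∫ ω in openConn o x, F (openCluster ω x) ∂(prodBernoulli w) := by
  have key := lemma3_i_real w z x F hF h (isUpperSet_connFamily x o)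
  rw [← openConn_eq_setOf_connFamily, openConn_symm x o] at key
  exact key

/-- **(GΨ₂) inside a vertex set**: for every `S`, if `E F(C(z)) ≤ E F(C(x))` then
`E[F(C(z)); o ↔ x in S] ≤ E[F(C(x)); o ↔ x in S]` (`{o ↔ x in S}` is an increasing event of the cluster of `x`,
`Q7Psi.mem_openConnIn_iff_of_cluster_subset`).  With `S = {b}ᶜ` on the graph `G ∖ b` and
`F(C) = 1 − ∏_{s∈C}(1 − w_{sb})` this is the cluster-property reading of `Q7Psi.psi_single`.
[cite: KozmaNitzan2024, Lemma 3(i) (pp. 6–7), §5.1 (pp. 31–32), Question 7 (p. 36)] -/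
theorem gpsi_two_in (w : Sym2 V → unitInterval) (S : Set V) (o x z : V) (F : Set V → ℝ)
    (hF : ∀ S T : Set V, S ⊆ T → F S ≤ F T)
    (h : ∫ ω, F (openCluster ω z) ∂(prodBernoulli w) ≤ ∫ ω, F (openCluster ω x) ∂(prodBernoulli w)) :
    ∫ ω in openConnIn S o x, F (openCluster ω z) ∂(prodBernoulli w) ≤
      ∫ ω in openConnIn S o x, F (openCluster ω x) ∂(prodBernoulli w) := by
  set 𝒬 : Set (Set (Sym2 V)) := (openConnIn S x o : Set (BondConfig V)) with h𝒬def
  have h𝒬 : IsUpperSet 𝒬 := isUpperSet_openConnIn S x o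
  have hev : {ω : BondConfig V | openEdgeCluster ω x ∈ 𝒬} = openConnIn S o x := by
    rw [openConnIn_comm S o x]
    ext ω
    exact mem_openConnIn_iff_of_cluster_subset subset_rfl (openEdgeCluster_subset ω x)
  have key := lemma3_i_real w z x F hF h h𝒬
  rw [hev] at key
  exact key

end Q7Psi

end

end Summit.CriticalPhenomena.PercolationContinuityZ3.Theorems
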